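import Summits.BirchSwinnertonDyer.BirchSwinnertonDyer.Theorems.ThetaPartnerAtTwoSignedMainConjectureCMTwoRankZeroFlatTwistImaginaryDescent
import Summits.BirchSwinnertonDyer.BirchSwinnertonDyer.Theorems.ThetaPartnerAtTwoSignedMainConjectureCMTwoRankZeroFlatLevelSixteen
import HarnessLib

/-!
# Route `ThetaPartnerAtTwo`, crux K2r0P `SignedMainConjectureCMTwoRankZeroOfPub` (stmt-BirchSwinnertonDyer-24945),
# line `rankzero` v14, stub (μ♭)_A: imaginary prime quadratic twists, part 2b — transport of the residual FLAT certificate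
# between two imaginary prime twists of one base curve, GRANTED a displayed minus-period unit at the base

Cell `bsd-wall`, width seat `bsd-wall-tp2-p2-w3` (g2). THEOREMS ONLY (no `def`, no named fact, no `sorry`); helper `--supports`
the crux; sequel of `…FlatTwistImaginary` and `…FlatTwistImaginaryDescent`. BSD is not proved by any of this.

For `W` globally minimal, good at `2` with `2 ∣ a₂(W)`, `Δ(W) < 0`, and `A` a globally minimal model of `W^{(d)}` (`d < 0`, `|d|`
prime, `d ≡ 1 (mod 4)`, `(d, N_W) = 1`), granted `hmod`, `h2` and the DISPLAYED minus unit `Ω⁻(W) = ϖ·Ω⁻_{f_W}`, `|ϖ|₂ = 1`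
(a hypothesis, not a tree fact):
* `exists_odd_negTwist_of_exists_oddMinus` / `exists_oddMinus_of_exists_odd_negTwist` — the plus certificate of `f_A`
  («some `[b/4^k]⁺ − [0]⁺` is half an odd integer») and the minus certificate of `f_W` («some `2[b/4^k]⁻` is odd») are
  EQUIVALENT;
* `flatAtTwo_negTwist_of_exists_oddMinus` (`a₂(W) = 0`, `L(A,1) ≠ 0` ⇒ `2 ∤ L♭` for every Pollack pair of `f_A`),
  `analyticMuFlat_negTwist_at_of_exists_oddMinus` (the stub's currency);
* **`analyticMuFlat_negTwist_at_of_sibling`** — (μ♭) at `A` from the plus certificate of ANOTHER imaginary prime twist `A₁` of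
  the same `W`; anchors `analyticMuFlat_negTwist_at_of_flatAtTwo_anchor` (FLAT at a rank-0 `A₁`),
  `analyticMuFlat_negTwist_at_of_unitZone_anchor`, `analyticMuFlat_negTwist_at_of_levelSixteen_anchor` (PUB facts by name;
  e.g. `W = 121b`, `A₁ = 5929a = W^{(−7)}` level-16-certified, `A = W^{(−q)}`).

References: B. Mazur, J. Tate, J. Teitelbaum, Invent. Math. 84 (1986) §I.8 [MazurTateTeitelbaum1986Invent]; V. Pal, Proc. AMS
140 (2012) Thm. 3.2 [Pal2012]; R. Pollack, Duke Math. J. 118 (2003) Prop. 6.18 [Pollack2003]; S. Kobayashi, Invent. Math. 152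
(2003) Thm. 1.2 [Kobayashi2003]; A. Burungale, M. Flach (2024) Thm. 1.1 [BurungaleFlach2024].
-/

set_option autoImplicit false
-- the Theorems namespace of this sub repeats the summit name by design (D-0017 nested layout)
set_option linter.dupNamespace false

noncomputable section

open scoped Classical MatrixGroups ModularForm NumberField NumberTheorySymbols

open NumberField IsDedekindDomain Rat.HeightOneSpectrum CongruenceSubgroup
  Literature.NumberTheory.EllipticCurves Literature.NumberTheory.GaloisRepresentations
  WeierstrassCurve Literature.NumberTheory.EllipticCurves.ModularForms Literature.NumberTheory.EllipticCurves.Rank1Residual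
  Literature.NumberTheory.EllipticCurves.Rank1Residual.Typed
  Summit.BirchSwinnertonDyer.Rank1Residual Summit.BirchSwinnertonDyer.Rank1Residual.Supersingular

namespace Summit.BirchSwinnertonDyer.BirchSwinnertonDyer.Theorems.FlatTwist.Imaginary

/-! ## Imaginary prime twists of one base curve: equivalence of certificates, FLAT, siblings, anchors -/

section Curves

variable (W : WeierstrassCurve ℚ) [W.IsElliptic] [W.IsGloballyMinimal] {d : ℤ} {A : WeierstrassCurve ℚ}
  [A.IsElliptic] [A.IsGloballyMinimal] [NeZero (W.conductorNorm ℤ)] [NeZero (A.conductorNorm ℤ)]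
  {fW : CuspForm (Gamma0 (W.conductorNorm ℤ)) 2} {fA : CuspForm (Gamma0 (A.conductorNorm ℤ)) 2}

/-- **MINUS CERTIFICATE AT THE BASE ⟹ PLUS CERTIFICATE AT THE NEGATIVE TWIST.** `W` globally minimal, good at `2` with
`2 ∣ a₂(W)`, `Δ(W) < 0`; `d < 0`, `|d|` prime, `d ≡ 1 (mod 4)`, `(d, N_W) = 1`; `A` a globally minimal model of `W^{(d)}`; newforms
`f_W`, `f_A`; some `[x]⁺_{f_A} ≠ 0`; granted `hmod`, `h2` and the displayed minus unit `Ω⁻(W) = ϖ·Ω⁻_{f_W}`, `|ϖ|₂ = 1`. If some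
`2[b/4^k]⁻_{f_W}` (`k ≥ 1`, `b` odd) is ODD, then some `[b'/4^{k'}]⁺_{f_A} − [0]⁺_{f_A}` is half an odd integer.
[cite: MazurTateTeitelbaum1986Invent, §I.4 (4.2), §I.8] [cite: Pal2012, Thm. 3.2 (case d < 0)] [cite: EmertonPollackWeston2006, §4.4] -/
theorem exists_odd_negTwist_of_exists_oddMinus (hmod : exists_isNewformOf)
    (h2 : Literature.NumberTheory.EllipticCurves.realPeriodRat_eq_unit_mul_plusPeriod_two)
    (hss : GoodSS W 2) (hΔ : W.Δ < 0) (hd : d < 0) (hd4 : d % 4 = 1) (hp : d.natAbs.Prime)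
    (hcop : IsCoprime d (W.conductorNorm ℤ : ℤ)) {C : VariableChange ℚ} (hA : C • W.quadraticTwist (d : ℚ) = A)
    (hfW : IsNewformOf W fW) (hfA : IsNewformOf A fA) (hnz : ∃ x : ℚ, ratPlusSymbol fA x ≠ 0)
    {ϖ : ℚ} (hϖ1 : ‖(ϖ : ℚ_[2])‖ = 1) (hϖ : W.imaginaryPeriodRat = (ϖ : ℝ) * minusPeriod fW)
    (hres : ∃ k : ℕ, 1 ≤ k ∧ ∃ b : ℤ, Odd b ∧ ∃ m : ℤ, Odd m ∧ 2 * ratMinusSymbol fW ((b : ℚ) / 4 ^ k) = m) :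
    ∃ k : ℕ, 1 ≤ k ∧ ∃ b : ℤ, Odd b ∧ ∃ m : ℤ, Odd m ∧
      ratPlusSymbol fA ((b : ℚ) / 4 ^ k) = ratPlusSymbol fA 0 + (m : ℚ) / 2 := by
  haveI : Fact (Nat.Prime 2) := ⟨Nat.prime_two⟩
  obtain ⟨S, hS, hodd, hcong⟩ :=
    exists_plusMinus_congruence_negTwist W hmod h2 hss hΔ hd hd4 hp hcop hA hfW hfA hnz hϖ1 hϖ
  have hsq : Squarefree d := Int.squarefree_natAbs.mp hp.squarefree
  have h2d : ¬ (2 : ℤ) ∣ d := by omega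
  obtain ⟨hgoodA, -⟩ := hasGoodReductionAtPrime_twist_and_frobeniusTrace_eq W 2 hmod hd4 hsq hcop hA hss.1 h2d
  have h2NA : ¬ 2 ∣ A.conductorNorm ℤ := not_dvd_level_of_isNewformOf hfA hgoodA
  have h2NW : ¬ 2 ∣ W.conductorNorm ℤ := not_dvd_level_of_isNewformOf hfW hss.1
  have haW2 : cuspCoeff fW 2 = ((W.frobeniusTrace 2 : ℤ) : ℂ) := cuspCoeff_eq_frobeniusTrace_of_isNewformOf_holds hfW hss.1
  have haev : Even (W.frobeniusTrace 2) := even_iff_two_dvd.mpr hss.2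
  exact exists_odd_of_plusMinus_congruence fA fW hfA.coeffField_eq_bot h2NA hfW.1 hfW.coeffField_eq_bot h2NW haW2 haev
    S hS hodd hcong hres

/-- **PLUS CERTIFICATE AT THE NEGATIVE TWIST ⟹ MINUS CERTIFICATE AT THE BASE** (same setting; the non-vanishing of some
`[x]⁺_{f_A}` follows from the certificate itself). So, granted the displayed minus unit at `W`, «some `2[b/4^k]⁻_{f_W}` is odd» is
the common invariant of ALL admissible negative prime twists of `W`. [cite: MazurTateTeitelbaum1986Invent, §I.8] [cite: Pal2012, Thm. 3.2] -/
theorem exists_oddMinus_of_exists_odd_negTwist (hmod : exists_isNewformOf)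
    (h2 : Literature.NumberTheory.EllipticCurves.realPeriodRat_eq_unit_mul_plusPeriod_two)
    (hss : GoodSS W 2) (hΔ : W.Δ < 0) (hd : d < 0) (hd4 : d % 4 = 1) (hp : d.natAbs.Prime)
    (hcop : IsCoprime d (W.conductorNorm ℤ : ℤ)) {C : VariableChange ℚ} (hA : C • W.quadraticTwist (d : ℚ) = A)
    (hfW : IsNewformOf W fW) (hfA : IsNewformOf A fA)
    {ϖ : ℚ} (hϖ1 : ‖(ϖ : ℚ_[2])‖ = 1) (hϖ : W.imaginaryPeriodRat = (ϖ : ℝ) * minusPeriod fW)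
    (hres : ∃ k : ℕ, 1 ≤ k ∧ ∃ b : ℤ, Odd b ∧ ∃ m : ℤ, Odd m ∧
      ratPlusSymbol fA ((b : ℚ) / 4 ^ k) = ratPlusSymbol fA 0 + (m : ℚ) / 2) :
    ∃ k : ℕ, 1 ≤ k ∧ ∃ b : ℤ, Odd b ∧ ∃ m : ℤ, Odd m ∧ 2 * ratMinusSymbol fW ((b : ℚ) / 4 ^ k) = m := by
  haveI : Fact (Nat.Prime 2) := ⟨Nat.prime_two⟩
  have hnz : ∃ x : ℚ, ratPlusSymbol fA x ≠ 0 := by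
    obtain ⟨k, -, b, -, m, hmo, hmeq⟩ := hres
    by_contra hall
    push Not at hall
    rw [hall, hall] at hmeq
    have hm0 : (m : ℚ) = 0 := by linarith
    have : m = 0 := by exact_mod_cast hm0
    rw [this] at hmo
    exact (by decide : ¬ Odd (0 : ℤ)) hmo
  obtain ⟨S, -, hodd, hcong⟩ :=
    exists_plusMinus_congruence_negTwist W hmod h2 hss hΔ hd hd4 hp hcop hA hfW hfA hnz hϖ1 hϖ
  have h2NW : ¬ 2 ∣ W.conductorNorm ℤ := not_dvd_level_of_isNewformOf hfW hss.1
  exact exists_oddMinus_of_plusMinus_congruence fA fW hfW.coeffField_eq_bot h2NW S hodd hcong hres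

/-- **FLAT AT A NEGATIVE PRIME TWIST from the minus certificate at the base** (`a₂(W) = 0`, `L(A,1) ≠ 0`): for every Pollack
pair `(L♯, L♭)` of `f_A` at `2`, `2 ∤ L♭`. [cite: Pollack2003, Prop. 6.18] [cite: MazurTateTeitelbaum1986Invent, §I.8] -/
theorem flatAtTwo_negTwist_of_exists_oddMinus (hmod : exists_isNewformOf)
    (h2 : Literature.NumberTheory.EllipticCurves.realPeriodRat_eq_unit_mul_plusPeriod_two)
    (hss : GoodSS W 2) (haW : W.frobeniusTrace 2 = 0) (hΔ : W.Δ < 0) (hd : d < 0) (hd4 : d % 4 = 1)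
    (hp : d.natAbs.Prime) (hcop : IsCoprime d (W.conductorNorm ℤ : ℤ)) {C : VariableChange ℚ}
    (hA : C • W.quadraticTwist (d : ℚ) = A) (hfW : IsNewformOf W fW) (hfA : IsNewformOf A fA)
    (hLA : A.entireLFunction 1 ≠ 0)
    {ϖ : ℚ} (hϖ1 : ‖(ϖ : ℚ_[2])‖ = 1) (hϖ : W.imaginaryPeriodRat = (ϖ : ℝ) * minusPeriod fW)
    (hres : ∃ k : ℕ, 1 ≤ k ∧ ∃ b : ℤ, Odd b ∧ ∃ m : ℤ, Odd m ∧ 2 * ratMinusSymbol fW ((b : ℚ) / 4 ^ k) = m) :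
    ∀ Lplus Lminus : IwasawaAlgebra 2, IsPollackPair fA 2 Lplus Lminus → ¬ PowerSeries.C (2 : ℤ_[2]) ∣ Lminus := by
  haveI : Fact (Nat.Prime 2) := ⟨Nat.prime_two⟩
  have hnz : ∃ x : ℚ, ratPlusSymbol fA x ≠ 0 :=
    ⟨0, fun h ↦ hLA (by rw [hfA.entireLFunction_one_eq, h]; simp)⟩
  have hresA := exists_odd_negTwist_of_exists_oddMinus W hmod h2 hss hΔ hd hd4 hp hcop hA hfW hfA hnz hϖ1 hϖ hres
  have hsq : Squarefree d := Int.squarefree_natAbs.mp hp.squarefree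
  have h2d : ¬ (2 : ℤ) ∣ d := by omega
  obtain ⟨hgoodA, haA⟩ := hasGoodReductionAtPrime_twist_and_frobeniusTrace_eq W 2 hmod hd4 hsq hcop hA hss.1 h2d
  have haA0 : A.frobeniusTrace 2 = 0 := by rw [haA, haW, mul_zero]
  have hssA : GoodSS A 2 := ⟨hgoodA, by rw [haA0]; exact dvd_zero _⟩
  have h2NA : ¬ 2 ∣ A.conductorNorm ℤ := not_dvd_level_of_isNewformOf hfA hgoodA
  have haA2 : cuspCoeff fA 2 = ((0 : ℤ) : ℂ) := by
    rw [cuspCoeff_eq_frobeniusTrace_of_isNewformOf_holds hfA hgoodA, haA0]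
  -- the old-class FLAT lemma with the trivial class `S = {1}`, `g = f_A`
  refine SignedMuAtTwo.flatAtTwo_of_plusSymbol_congruence hfA hssA haA0 fA hfA.1 hfA.coeffField_eq_bot h2NA haA2
    (by decide) {1} (Finset.singleton_nonempty 1) (fun t ht ↦ by rw [Finset.mem_singleton.mp ht]; exact odd_one) ?_ hresA
  intro k _ b _
  refine ⟨0, ?_⟩
  rw [Finset.sum_singleton]
  push_cast
  ring

/-- The same in the registered stub's currency `∃ n, IsUnit (coeff n (kobayashiL 1 L⁺ L⁻))`.
[cite: Kobayashi2003, Thm. 1.2] [cite: Pollack2003, Prop. 6.18] -/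
theorem analyticMuFlat_negTwist_at_of_exists_oddMinus (hmod : exists_isNewformOf)
    (h2 : Literature.NumberTheory.EllipticCurves.realPeriodRat_eq_unit_mul_plusPeriod_two)
    (hss : GoodSS W 2) (haW : W.frobeniusTrace 2 = 0) (hΔ : W.Δ < 0) (hd : d < 0) (hd4 : d % 4 = 1)
    (hp : d.natAbs.Prime) (hcop : IsCoprime d (W.conductorNorm ℤ : ℤ)) {C : VariableChange ℚ}
    (hA : C • W.quadraticTwist (d : ℚ) = A) (hfW : IsNewformOf W fW) (hfA : IsNewformOf A fA)
    (hLA : A.entireLFunction 1 ≠ 0)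
    {ϖ : ℚ} (hϖ1 : ‖(ϖ : ℚ_[2])‖ = 1) (hϖ : W.imaginaryPeriodRat = (ϖ : ℝ) * minusPeriod fW)
    (hres : ∃ k : ℕ, 1 ≤ k ∧ ∃ b : ℤ, Odd b ∧ ∃ m : ℤ, Odd m ∧ 2 * ratMinusSymbol fW ((b : ℚ) / 4 ^ k) = m)
    (Lplus Lminus : IwasawaAlgebra 2) (hPP : IsPollackPair fA 2 Lplus Lminus) :
    ∃ n : ℕ, IsUnit (PowerSeries.coeff n (kobayashiL 1 Lplus Lminus)) := by
  rw [kobayashiL_one]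
  exact exists_isUnit_coeff_of_not_C_two_dvd
    (flatAtTwo_negTwist_of_exists_oddMinus W hmod h2 hss haW hΔ hd hd4 hp hcop hA hfW hfA hLA hϖ1 hϖ hres Lplus Lminus hPP)

/-- **(μ♭) AT A NEGATIVE PRIME TWIST FROM A SIBLING.** Same base `W` (`a₂(W) = 0`, `Δ(W) < 0`, displayed minus unit), two
negative prime twists: `A₁` a globally minimal model of `W^{(d₁)}` carrying the plus certificate (e.g. level-16-certified, or on
the unit zone, or FLAT of rank `0`), and `A` one of `W^{(d)}` with `L(A,1) ≠ 0`. Then (μ♭) holds at every Pollack pair of `f_A`.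
[cite: MazurTateTeitelbaum1986Invent, §I.8] [cite: Pal2012, Thm. 3.2 (case d < 0)] [cite: Pollack2003, Prop. 6.18] -/
theorem analyticMuFlat_negTwist_at_of_sibling (hmod : exists_isNewformOf)
    (h2 : Literature.NumberTheory.EllipticCurves.realPeriodRat_eq_unit_mul_plusPeriod_two)
    (hss : GoodSS W 2) (haW : W.frobeniusTrace 2 = 0) (hΔ : W.Δ < 0) (hfW : IsNewformOf W fW)
    {ϖ : ℚ} (hϖ1 : ‖(ϖ : ℚ_[2])‖ = 1) (hϖ : W.imaginaryPeriodRat = (ϖ : ℝ) * minusPeriod fW)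
    {d₁ : ℤ} (hd₁ : d₁ < 0) (hd₁4 : d₁ % 4 = 1) (hp₁ : d₁.natAbs.Prime) (hcop₁ : IsCoprime d₁ (W.conductorNorm ℤ : ℤ))
    {A₁ : WeierstrassCurve ℚ} [A₁.IsElliptic] [A₁.IsGloballyMinimal] [NeZero (A₁.conductorNorm ℤ)] {C₁ : VariableChange ℚ}
    (hA₁ : C₁ • W.quadraticTwist (d₁ : ℚ) = A₁) {f₁ : CuspForm (Gamma0 (A₁.conductorNorm ℤ)) 2} (hf₁ : IsNewformOf A₁ f₁)
    (hres : ∃ k : ℕ, 1 ≤ k ∧ ∃ b : ℤ, Odd b ∧ ∃ m : ℤ, Odd m ∧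
      ratPlusSymbol f₁ ((b : ℚ) / 4 ^ k) = ratPlusSymbol f₁ 0 + (m : ℚ) / 2)
    (hd : d < 0) (hd4 : d % 4 = 1) (hp : d.natAbs.Prime) (hcop : IsCoprime d (W.conductorNorm ℤ : ℤ))
    {C : VariableChange ℚ} (hA : C • W.quadraticTwist (d : ℚ) = A) (hfA : IsNewformOf A fA)
    (hLA : A.entireLFunction 1 ≠ 0) (Lplus Lminus : IwasawaAlgebra 2) (hPP : IsPollackPair fA 2 Lplus Lminus) :
    ∃ n : ℕ, IsUnit (PowerSeries.coeff n (kobayashiL 1 Lplus Lminus)) :=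
  analyticMuFlat_negTwist_at_of_exists_oddMinus W hmod h2 hss haW hΔ hd hd4 hp hcop hA hfW hfA hLA hϖ1 hϖ
    (exists_oddMinus_of_exists_odd_negTwist W hmod h2 hss hΔ hd₁ hd₁4 hp₁ hcop₁ hA₁ hfW hf₁ hϖ1 hϖ hres) Lplus Lminus hPP

/-- **ANCHOR: FLAT AT A RANK-ZERO NEGATIVE SIBLING.** As above with the plus certificate of `A₁` replaced by FLAT at `(A₁, f₁)`
(`A₁` of analytic rank `0`, good supersingular at `2` with `a₂(A₁) = 0` — automatic for a twist of `W` — via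
`FlatTwist.Squarefree.exists_odd_of_flatAtTwo`): FLAT is CLOSED under passing between admissible negative prime twists of one
base curve with the displayed minus unit. [cite: Pollack2003, Prop. 6.18] [cite: MazurTateTeitelbaum1986Invent, §I.8] -/
theorem analyticMuFlat_negTwist_at_of_flatAtTwo_anchor (hmod : exists_isNewformOf)
    (h2 : Literature.NumberTheory.EllipticCurves.realPeriodRat_eq_unit_mul_plusPeriod_two)
    (hss : GoodSS W 2) (haW : W.frobeniusTrace 2 = 0) (hΔ : W.Δ < 0) (hfW : IsNewformOf W fW)
    {ϖ : ℚ} (hϖ1 : ‖(ϖ : ℚ_[2])‖ = 1) (hϖ : W.imaginaryPeriodRat = (ϖ : ℝ) * minusPeriod fW)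
    {d₁ : ℤ} (hd₁ : d₁ < 0) (hd₁4 : d₁ % 4 = 1) (hp₁ : d₁.natAbs.Prime) (hcop₁ : IsCoprime d₁ (W.conductorNorm ℤ : ℤ))
    {A₁ : WeierstrassCurve ℚ} [A₁.IsElliptic] [A₁.IsGloballyMinimal] [NeZero (A₁.conductorNorm ℤ)] {C₁ : VariableChange ℚ}
    (hA₁ : C₁ • W.quadraticTwist (d₁ : ℚ) = A₁) {f₁ : CuspForm (Gamma0 (A₁.conductorNorm ℤ)) 2} (hf₁ : IsNewformOf A₁ f₁)
    (hr₁ : A₁.analyticRank = 0)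
    (hflat₁ : ∀ Lplus Lminus : IwasawaAlgebra 2, IsPollackPair f₁ 2 Lplus Lminus → ¬ PowerSeries.C (2 : ℤ_[2]) ∣ Lminus)
    (hd : d < 0) (hd4 : d % 4 = 1) (hp : d.natAbs.Prime) (hcop : IsCoprime d (W.conductorNorm ℤ : ℤ))
    {C : VariableChange ℚ} (hA : C • W.quadraticTwist (d : ℚ) = A) (hfA : IsNewformOf A fA)
    (hLA : A.entireLFunction 1 ≠ 0) (Lplus Lminus : IwasawaAlgebra 2) (hPP : IsPollackPair fA 2 Lplus Lminus) :
    ∃ n : ℕ, IsUnit (PowerSeries.coeff n (kobayashiL 1 Lplus Lminus)) := by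
  haveI : Fact (Nat.Prime 2) := ⟨Nat.prime_two⟩
  have hsq₁ : Squarefree d₁ := Int.squarefree_natAbs.mp hp₁.squarefree
  have h2d₁ : ¬ (2 : ℤ) ∣ d₁ := by omega
  obtain ⟨hgood₁, ha₁⟩ := hasGoodReductionAtPrime_twist_and_frobeniusTrace_eq W 2 hmod hd₁4 hsq₁ hcop₁ hA₁ hss.1 h2d₁
  have ha₁0 : A₁.frobeniusTrace 2 = 0 := by rw [ha₁, haW, mul_zero]
  have hss₁ : GoodSS A₁ 2 := ⟨hgood₁, by rw [ha₁0]; exact dvd_zero _⟩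
  have hres := FlatTwist.Squarefree.exists_odd_of_flatAtTwo hf₁ hss₁ ha₁0 hr₁ hflat₁
  exact analyticMuFlat_negTwist_at_of_sibling W hmod h2 hss haW hΔ hfW hϖ1 hϖ hd₁ hd₁4 hp₁ hcop₁ hA₁ hf₁ hres hd hd4 hp
    hcop hA hfA hLA Lplus Lminus hPP

/-- **ANCHOR FROM PRINT: A UNIT-ZONE NEGATIVE SIBLING.** `A₁` CM of analytic rank `0`, good supersingular at `2` with
`a₂(A₁) = 0`, `2 ∤ #Ш(A₁)·∏c_ℓ(A₁)` (PUB facts `hBF hLrat hGZK h2` by name; `FlatTwist.exists_odd_of_unitZone`).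
[cite: BurungaleFlach2024, Thm. 1.1] [cite: Pollack2003, Prop. 6.18] -/
theorem analyticMuFlat_negTwist_at_of_unitZone_anchor
    (hBF : bsdTriple_of_hasCM_of_L_one_ne_zero) (hmod : exists_isNewformOf) (hLrat : hasEntireLFunction_rat)
    (hGZK : rank_eq_analyticRank_of_analyticRank_le_one)
    (h2 : Literature.NumberTheory.EllipticCurves.realPeriodRat_eq_unit_mul_plusPeriod_two)
    (hss : GoodSS W 2) (haW : W.frobeniusTrace 2 = 0) (hΔ : W.Δ < 0) (hfW : IsNewformOf W fW)
    {ϖ : ℚ} (hϖ1 : ‖(ϖ : ℚ_[2])‖ = 1) (hϖ : W.imaginaryPeriodRat = (ϖ : ℝ) * minusPeriod fW)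
    {d₁ : ℤ} (hd₁ : d₁ < 0) (hd₁4 : d₁ % 4 = 1) (hp₁ : d₁.natAbs.Prime) (hcop₁ : IsCoprime d₁ (W.conductorNorm ℤ : ℤ))
    {A₁ : WeierstrassCurve ℚ} [A₁.IsElliptic] [A₁.IsGloballyMinimal] [NeZero (A₁.conductorNorm ℤ)] {C₁ : VariableChange ℚ}
    (hA₁ : C₁ • W.quadraticTwist (d₁ : ℚ) = A₁) {f₁ : CuspForm (Gamma0 (A₁.conductorNorm ℤ)) 2} (hf₁ : IsNewformOf A₁ f₁)
    (hcm₁ : A₁.HasCM) (hr₁ : A₁.analyticRank = 0) (hunit₁ : ¬ 2 ∣ A₁.shaOrder * A₁.tamagawaProduct)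
    (hd : d < 0) (hd4 : d % 4 = 1) (hp : d.natAbs.Prime) (hcop : IsCoprime d (W.conductorNorm ℤ : ℤ))
    {C : VariableChange ℚ} (hA : C • W.quadraticTwist (d : ℚ) = A) (hfA : IsNewformOf A fA) (hrA : A.analyticRank = 0)
    (Lplus Lminus : IwasawaAlgebra 2) (hPP : IsPollackPair fA 2 Lplus Lminus) :
    ∃ n : ℕ, IsUnit (PowerSeries.coeff n (kobayashiL 1 Lplus Lminus)) := by
  haveI : Fact (Nat.Prime 2) := ⟨Nat.prime_two⟩
  have hsq₁ : Squarefree d₁ := Int.squarefree_natAbs.mp hp₁.squarefree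
  have h2d₁ : ¬ (2 : ℤ) ∣ d₁ := by omega
  obtain ⟨hgood₁, ha₁⟩ := hasGoodReductionAtPrime_twist_and_frobeniusTrace_eq W 2 hmod hd₁4 hsq₁ hcop₁ hA₁ hss.1 h2d₁
  have ha₁0 : A₁.frobeniusTrace 2 = 0 := by rw [ha₁, haW, mul_zero]
  have hss₁ : GoodSS A₁ 2 := ⟨hgood₁, by rw [ha₁0]; exact dvd_zero _⟩
  have hres := FlatTwist.exists_odd_of_unitZone A₁ hBF hLrat hGZK h2 hcm₁ hr₁ hss₁ ha₁0 hunit₁ hf₁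
  have hLA : A.entireLFunction 1 ≠ 0 := (A.analyticRank_eq_zero_iff_holds (hLrat A)).mp hrA
  exact analyticMuFlat_negTwist_at_of_sibling W hmod h2 hss haW hΔ hfW hϖ1 hϖ hd₁ hd₁4 hp₁ hcop₁ hA₁ hf₁ hres hd hd4 hp
    hcop hA hfA hLA Lplus Lminus hPP

/-- **ANCHOR FROM PRINT: A LEVEL-16-CERTIFIED NEGATIVE SIBLING.** `A₁` CM of analytic rank `0`, good supersingular at `2` with
`a₂(A₁) = 0`, `N_{A₁} ≡ ±1 (mod 8)` and `ord₂ #Ш(A₁) + ord₂ ∏c_ℓ(A₁) = 1` (PUB facts by name;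
`FlatLevelSixteen.exists_odd_sixteenth_of_padicValRat_eq_one`). E.g. `W = 121b`, `A₁ = 5929a = W^{(−7)}`, `A = W^{(−q)}`.
[cite: BurungaleFlach2024, Thm. 1.1] [cite: MazurTateTeitelbaum1986Invent, §II.13] [cite: Pollack2003, Prop. 6.18] -/
theorem analyticMuFlat_negTwist_at_of_levelSixteen_anchor
    (hBF : bsdTriple_of_hasCM_of_L_one_ne_zero) (hmod : exists_isNewformOf) (hLrat : hasEntireLFunction_rat)
    (hGZK : rank_eq_analyticRank_of_analyticRank_le_one)
    (h2 : Literature.NumberTheory.EllipticCurves.realPeriodRat_eq_unit_mul_plusPeriod_two)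
    (hss : GoodSS W 2) (haW : W.frobeniusTrace 2 = 0) (hΔ : W.Δ < 0) (hfW : IsNewformOf W fW)
    {ϖ : ℚ} (hϖ1 : ‖(ϖ : ℚ_[2])‖ = 1) (hϖ : W.imaginaryPeriodRat = (ϖ : ℝ) * minusPeriod fW)
    {d₁ : ℤ} (hd₁ : d₁ < 0) (hd₁4 : d₁ % 4 = 1) (hp₁ : d₁.natAbs.Prime) (hcop₁ : IsCoprime d₁ (W.conductorNorm ℤ : ℤ))
    {A₁ : WeierstrassCurve ℚ} [A₁.IsElliptic] [A₁.IsGloballyMinimal] [NeZero (A₁.conductorNorm ℤ)] {C₁ : VariableChange ℚ}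
    (hA₁ : C₁ • W.quadraticTwist (d₁ : ℚ) = A₁) {f₁ : CuspForm (Gamma0 (A₁.conductorNorm ℤ)) 2} (hf₁ : IsNewformOf A₁ f₁)
    (hcm₁ : A₁.HasCM) (hr₁ : A₁.analyticRank = 0)
    (hN₁ : A₁.conductorNorm ℤ % 8 = 1 ∨ A₁.conductorNorm ℤ % 8 = 7)
    (hz₁ : padicValNat 2 A₁.shaOrder + padicValNat 2 A₁.tamagawaProduct = 1)
    (hd : d < 0) (hd4 : d % 4 = 1) (hp : d.natAbs.Prime) (hcop : IsCoprime d (W.conductorNorm ℤ : ℤ))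
    {C : VariableChange ℚ} (hA : C • W.quadraticTwist (d : ℚ) = A) (hfA : IsNewformOf A fA) (hrA : A.analyticRank = 0)
    (Lplus Lminus : IwasawaAlgebra 2) (hPP : IsPollackPair fA 2 Lplus Lminus) :
    ∃ n : ℕ, IsUnit (PowerSeries.coeff n (kobayashiL 1 Lplus Lminus)) := by
  haveI : Fact (Nat.Prime 2) := ⟨Nat.prime_two⟩
  have hsq₁ : Squarefree d₁ := Int.squarefree_natAbs.mp hp₁.squarefree
  have h2d₁ : ¬ (2 : ℤ) ∣ d₁ := by omega
  obtain ⟨hgood₁, ha₁⟩ := hasGoodReductionAtPrime_twist_and_frobeniusTrace_eq W 2 hmod hd₁4 hsq₁ hcop₁ hA₁ hss.1 h2d₁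
  have ha₁0 : A₁.frobeniusTrace 2 = 0 := by rw [ha₁, haW, mul_zero]
  have hss₁ : GoodSS A₁ 2 := ⟨hgood₁, by rw [ha₁0]; exact dvd_zero _⟩
  have hL₁ : A₁.entireLFunction 1 ≠ 0 := (A₁.analyticRank_eq_zero_iff_holds (hLrat A₁)).mp hr₁
  have hw : A₁.rootNumber = 1 := WeierstrassCurve.rootNumber_eq_one_of_entireLFunction_one_ne_zero hL₁
  have hFr : IsFrickeEigen (A₁.conductorNorm ℤ) f₁ (-((1 : ℤ) : ℂ)) := by
    have h := hf₁.isFrickeEigen_neg_rootNumber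
    rwa [hw] at h
  have hap : cuspCoeff f₁ 2 = ((0 : ℤ) : ℂ) := by
    rw [cuspCoeff_eq_frobeniusTrace_of_isNewformOf_holds hf₁ hgood₁, ha₁0]
  have h2N₁ : ¬ 2 ∣ A₁.conductorNorm ℤ := not_dvd_level_of_isNewformOf hf₁ hgood₁
  have hv : padicValRat 2 (ratPlusSymbol f₁ 0) = 1 := by
    rw [FlatLevelSixteen.padicValRat_ratPlusSymbol_zero_eq_of_pub A₁ hBF hLrat hGZK h2 hcm₁ hr₁ hss₁ hf₁]
    exact_mod_cast hz₁
  have hres := FlatLevelSixteen.exists_odd_sixteenth_of_padicValRat_eq_one hf₁.1 hf₁.coeffField_eq_bot h2N₁ hap hFr hN₁ hv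
  have hLA : A.entireLFunction 1 ≠ 0 := (A.analyticRank_eq_zero_iff_holds (hLrat A)).mp hrA
  exact analyticMuFlat_negTwist_at_of_sibling W hmod h2 hss haW hΔ hfW hϖ1 hϖ hd₁ hd₁4 hp₁ hcop₁ hA₁ hf₁ hres hd hd4 hp
    hcop hA hfA hLA Lplus Lminus hPP

end Curves

end Summit.BirchSwinnertonDyer.BirchSwinnertonDyer.Theorems.FlatTwist.Imaginary

end
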